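import Summits.AtomisticToContinuum.BoseEinsteinCondensation.Theorems.BECInsertionCorrectorBoundaryTransferWeakModeFreeRigidityTransferOfRigidity
import Summits.AtomisticToContinuum.BoseEinsteinCondensation.Theorems.BECInsertionCorrectorBoundaryTransferWeakModeFreeRigidityTransferLocBdd
import Summits.AtomisticToContinuum.BoseEinsteinCondensation.Theorems.BECInsertionCorrectorBoundaryTransferWeakCondensedMinimisersOfChord
import Summits.AtomisticToContinuum.BoseEinsteinCondensation.Theorems.BECGroundStateSOSBoundaryTransferWeakModeFreeRewardSplit
import Summits.AtomisticToContinuum.BoseEinsteinCondensation.Theses.BECHusimiAmplitudeGas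
import Summits.AtomisticToContinuum.BoseEinsteinCondensation.Theses.BECCutLineWeakDisorder
import Summits.AtomisticToContinuum.BoseEinsteinCondensation.Theses.BECInsertionCorrector
import Summits.AtomisticToContinuum.BoseEinsteinCondensation.Theses.BECPeriodicReduction

/-!
# `BoundaryTransferWeak` (stmt-AtomisticToContinuum-0827) closed modulo X₁ and Dirichlet rigidity

Line `mode_free_reward` of the crux (lead c6): with the two fixed-`N` stubs of piece X₂ landed
(`stub_condensedMinimisersOfChord`, p172484; `stub_modeFreeRigidityTransfer_locBdd`, p172452) and the conditional
transfer `modeFreeRigidityTransfer_of_groundStateRigidity` (p-wave 2), the crux is reduced, sorry-free and BY NAME, to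
two EXISTING items:

* `modeFreeSlopeToBEC_of_groundStateRigidity` — X₂ `ModeFreeSlopeToBEC` (stmt-18444, by name) follows from
  `GroundStateRigidity` (stmt-9072, by name); and `modeFreeSlopeToBECAt_of_essLocBdd` — X₂ holds OUTRIGHT for every
  admissible `v` essentially locally bounded on `(0, ∞)` (class (a) of stmt-9072, where rigidity is landed);
* `boundaryTransferWeak_of_chord_of_rigidity` — **crux 0827 ⟸ X₁ `ModeFreeRewardChord` (stmt-18443) ∧
  `GroundStateRigidity` (stmt-9072)**, on the lead's route `BECInsertionCorrector` and on the home route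
  `BECPeriodicReduction` (all copies `rfl`);
* `boundaryTransferAt_of_chord_of_essLocBdd` — for class (a) potentials the crux's implication `A(v) → B(v)` follows
  from X₁ ALONE.

So what remains of stmt-0827 is exactly X₁ (thermodynamic content; equivalently the over-condensation penalty,
`modeFreeRewardChord_iff_overCondensationPenalty`, p172744) plus, for singular potentials only, the uniqueness kernel
of stmt-9072. All `[folklore]` assemblies of landed theorems.
-/

noncomputable section

open MeasureTheory Filter
open scoped ENNReal NNReal

namespace Summit.AtomisticToContinuum.BoseEinsteinCondensation.ModeFreeReward

open Literature.MathematicalPhysics.QuantumManyBody.BoseGas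
open Summit.AtomisticToContinuum.BoseEinsteinCondensation.Theses.BECCutLineWeakDisorder (GroundStateRigidity)
open Summit.AtomisticToContinuum.BoseEinsteinCondensation.Theses.BECHusimiAmplitudeGas
  (ModeFreeRewardChord ModeFreeSlopeToBEC)

/-- **X₂ at one potential from a rigidity transfer at that potential** (the composition of the line's piece X₂:
stub 1 with `ε = c/4` gives condensed competitors at every slack with constant `c − c/4`; the transfer with
`c'' = c/2 < c − c/4` gives `condensateNumber ≥ (c/2) N`). [folklore] -/
theorem modeFreeSlopeToBECAt_of_transferAt {v : ℝ → ℝ≥0∞}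
    (h₂ : ∃ ρ₁ : ℝ, 0 < ρ₁ ∧ ∀ ρ : ℝ, 0 < ρ → ρ < ρ₁ →
      ∀ c' c'' : ℝ, 0 < c'' → c'' < c' → ∀ᶠ N : ℕ in atTop,
        groundStateEnergy v N (sideLength ρ N) ≠ ⊤ →
        (∀ η : ℝ≥0∞, 0 < η → ∃ Ψ : TrialState N (sideLength ρ N),
          energy v Ψ ≤ groundStateEnergy v N (sideLength ρ N) + η ∧
            ENNReal.ofReal (c' * N) ≤ maxOccupation N Ψ.ψ) →
        ENNReal.ofReal (c'' * N) ≤ condensateNumber v N (sideLength ρ N)) :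
    ∃ ρ₁ : ℝ, 0 < ρ₁ ∧ ∀ ρ : ℝ, 0 < ρ → ρ < ρ₁ → ∀ c : ℝ, 0 < c → c ≤ 1 →
      ∀ᶠ N : ℕ in atTop, groundStateEnergy v N (sideLength ρ N) ≠ ⊤ →
        (∃ lam₁ : ℝ, 0 < lam₁ ∧ ∀ lam : ℝ, 0 < lam → lam ≤ lam₁ →
          (⨅ Ψ : TrialState N (sideLength ρ N),
              energy v Ψ + ENNReal.ofReal lam * ((N : ℝ≥0∞) - maxOccupation N Ψ.ψ)) ≤
            groundStateEnergy v N (sideLength ρ N) + ENNReal.ofReal (lam * (1 - c) * N)) →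
        ENNReal.ofReal (c / 2 * N) ≤ condensateNumber v N (sideLength ρ N) := by
  obtain ⟨ρ₁, hρ₁, H⟩ := h₂
  refine ⟨ρ₁, hρ₁, fun ρ hρ hlt c hc hc1 => ?_⟩
  have hlt' : c / 2 < c - c / 4 := by linarith
  filter_upwards [H ρ hρ hlt (c - c / 4) (c / 2) (by positivity) hlt'] with N hN hE0 hchord
  obtain ⟨lam₁, hlam₁, hG⟩ := hchord
  exact hN hE0 fun η hη =>
    stub_condensedMinimisersOfChord v N (sideLength ρ N) c lam₁ hlam₁ hc hc1 hE0 hG η hη (c / 4) (by positivity)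

/-- **X₂ `ModeFreeSlopeToBEC` (stmt-AtomisticToContinuum-18444, by name) from `GroundStateRigidity`
(stmt-AtomisticToContinuum-9072, by name)** — every admissible `v`, hard cores included. [folklore] -/
theorem modeFreeSlopeToBEC_of_groundStateRigidity (hR : GroundStateRigidity) : ModeFreeSlopeToBEC :=
  fun v hv => modeFreeSlopeToBECAt_of_transferAt (modeFreeRigidityTransfer_of_groundStateRigidity hR v hv)

/-- **X₂ holds outright on class (a)**: for every admissible `v` essentially locally bounded on `(0, ∞)` the body
of `ModeFreeSlopeToBEC` at `v` is a theorem (landed rigidity, `stub_modeFreeRigidityTransfer_locBdd`). [folklore] -/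
theorem modeFreeSlopeToBECAt_of_essLocBdd {v : ℝ → ℝ≥0∞} (hv : IsRepulsiveFiniteRange v)
    (hlb : ∀ r : ℝ, 0 < r → ∃ C : ℝ≥0, ∀ᵐ s : ℝ, r ≤ s → v s ≤ C) :
    ∃ ρ₁ : ℝ, 0 < ρ₁ ∧ ∀ ρ : ℝ, 0 < ρ → ρ < ρ₁ → ∀ c : ℝ, 0 < c → c ≤ 1 →
      ∀ᶠ N : ℕ in atTop, groundStateEnergy v N (sideLength ρ N) ≠ ⊤ →
        (∃ lam₁ : ℝ, 0 < lam₁ ∧ ∀ lam : ℝ, 0 < lam → lam ≤ lam₁ →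
          (⨅ Ψ : TrialState N (sideLength ρ N),
              energy v Ψ + ENNReal.ofReal lam * ((N : ℝ≥0∞) - maxOccupation N Ψ.ψ)) ≤
            groundStateEnergy v N (sideLength ρ N) + ENNReal.ofReal (lam * (1 - c) * N)) →
        ENNReal.ofReal (c / 2 * N) ≤ condensateNumber v N (sideLength ρ N) :=
  modeFreeSlopeToBECAt_of_transferAt (stub_modeFreeRigidityTransfer_locBdd v hv hlb)

/-- **Crux `BoundaryTransferWeak` (stmt-AtomisticToContinuum-0827) ⟸ X₁ ∧ Dirichlet rigidity**, on the lead's route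
`BECInsertionCorrector`: `ModeFreeRewardChord` (stmt-18443) and `GroundStateRigidity` (stmt-9072) imply the crux, by the
landed glue `boundaryTransferWeak_of_modeFreeReward` (p164138) and `modeFreeSlopeToBEC_of_groundStateRigidity`.
[folklore] -/
theorem boundaryTransferWeak_of_chord_of_rigidity (h₁ : ModeFreeRewardChord) (hR : GroundStateRigidity) :
    Summit.AtomisticToContinuum.BoseEinsteinCondensation.Theses.BECInsertionCorrector.BoundaryTransferWeak :=
  boundaryTransferWeak_of_modeFreeReward h₁ (modeFreeSlopeToBEC_of_groundStateRigidity hR)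

/-- The same reduction for the home-route copy `BECPeriodicReduction.BoundaryTransferWeak` (definitionally the same
statement). [folklore] -/
theorem boundaryTransferWeak_periodicReduction_of_chord_of_rigidity (h₁ : ModeFreeRewardChord)
    (hR : GroundStateRigidity) :
    Summit.AtomisticToContinuum.BoseEinsteinCondensation.Theses.BECPeriodicReduction.BoundaryTransferWeak :=
  boundaryTransferWeak_of_chord_of_rigidity h₁ hR

/-- **On class (a) the crux's implication follows from X₁ alone**: for an admissible `v` essentially locally bounded
on `(0, ∞)`, `ModeFreeRewardChord` turns torus BEC at all small densities (the crux's hypothesis `A(v)`, verbatim)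
into Dirichlet ground-state BEC at all small densities (`B(v)`). [folklore] -/
theorem boundaryTransferAt_of_chord_of_essLocBdd (h₁ : ModeFreeRewardChord) {v : ℝ → ℝ≥0∞}
    (hv : IsRepulsiveFiniteRange v) (hlb : ∀ r : ℝ, 0 < r → ∃ C : ℝ≥0, ∀ᵐ s : ℝ, r ≤ s → v s ≤ C)
    (hA : ∃ ρ₀ : ℝ, 0 < ρ₀ ∧ ∀ ρ : ℝ, 0 < ρ → ρ < ρ₀ → ∃ c : ℝ, 0 < c ∧
      ∀ᶠ N : ℕ in atTop, ∃ δ : ℝ≥0∞, 0 < δ ∧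
        ∀ Ψ : PeriodicTrialState N (sideLength ρ N),
          periodicEnergy v Ψ ≤ periodicGroundStateEnergy v N (sideLength ρ N) + δ →
            ENNReal.ofReal (c * N) ≤ condensateOccupation N (sideLength ρ N) Ψ.ψ) :
    ∃ ρ₀ : ℝ, 0 < ρ₀ ∧ ∀ ρ : ℝ, 0 < ρ → ρ < ρ₀ → HasGroundStateBEC v ρ :=
  boundaryTransferAt_of_modeFreeReward hv (h₁ v hv) (modeFreeSlopeToBECAt_of_essLocBdd hv hlb) hA

end Summit.AtomisticToContinuum.BoseEinsteinCondensation.ModeFreeReward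

end
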